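import Mathlib.Order.Zorn
import Literature.Geometry.Lorentzian.KillingHorizonShadowAlong
import Literature.Geometry.Lorentzian.LeviCivitaLocality
import HarnessLib

/-!
# Continuation of a local Killing field along a connected open set, under local extendability
and coherence (no monodromy)

The classical continuation of Killing fields (K. Nomizu, Ann. of Math. 72 (1960) 105–120,
Theorems 1–2; pseudo-Riemannian form: P. T. Chruściel, Comm. Math. Phys. 189 (1997) 1–7,
Thm. 2.1) has two ingredients: (i) LOCAL EXTENDABILITY — every point has a connected open
neighbourhood `S` to which every Killing field given near any of its points extends (for analytic
metrics this is Nomizu's Theorem 1; in the tree it is supplied chartwise, for `C^∞` metrics with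
real-analytic components in a chart, by `MaxAtlasChart.exists_killingOn_source_mlieBracket_zero_eqOn`,
file `NomizuKillingExtensionChart.lean`); (ii) SINGLE-VALUEDNESS of the continuation, which print
derives from simple connectivity (Nomizu's Theorem 2: the monodromy argument).  This file proves
the continuation theorem with (ii) replaced by an explicit COHERENCE hypothesis — the operational
form of "no monodromy": two `T`-commuting local Killing fields on connected open subsets of the
region, the first extending the seed, which agree on a non-empty open subset of the intersection
of their domains, agree on the whole intersection — and with (i) as an explicit hypothesis.  Under
these, Zorn's lemma on the graphs of partial continuations gives a maximal continuation, and
maximal continuations are total on a connected region: the usual open–closed argument (Chruściel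
1997, proof of Thm. 1.1: "Simple connectedness and analyticity of `⟨⟨M_ext⟩⟩` together with
[Nomizu's theorem] allow us to conclude that the Killing vector `Y` can be globally extended").
Everything is stated for a `C^n` pseudo-Riemannian metric of any signature (`n ≥ 1`), a fixed
global vector field `T` (the commutation clause `[T, ·] = 0` is carried along; take `T = 0` to
ignore it), Killing fields on sets in the sense of `IsKillingFieldOn` (O'Neill 1983, Ch. 9,
Def. 9.22 on open submanifolds).

* `IsKillingFieldOn.of_locally`, `mlieBracket_eq_zero_of_locally` — the Killing property on a set
  and the commutation clause are local in the germ of the field (locality of the Levi-Civita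
  connection, `leviCivita_congr_nhds`, and of the Lie bracket).
* `IsKillingFieldOn.exists_extension_of_coherent` — **the continuation theorem**: on a connected
  open `A` with local extendability at every point and coherence, a `T`-commuting Killing field
  `Z₀` on a connected open non-empty `N₀ ⊆ A` extends to a `T`-commuting Killing field on `A`.

Everything here is proved; no definitions, no named facts.  Used by the crux
`NonTrappingHawkingRigidity` of the summit `FinalStateConjecture` (stub `stub_farAxialSeed`:
continuation of the near-horizon axial Killing field along the `T`-timelike region, where the
vacuum metric is real-analytic by Müller zum Hagen's theorem, the coherence being a registered
hypothesis of that crux line).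

## References
* K. Nomizu, Ann. of Math. (2) 72 (1960) 105–120, Thms. 1–2. [Nomizu1960]
* P. T. Chruściel, Comm. Math. Phys. 189 (1997) 1–7, gr-qc/9610011, Thm. 2.1 and proof of Thm. 1.1. [Chrusciel1997]
* B. O'Neill, *Semi-Riemannian geometry*, Academic Press 1983, Ch. 9, Def. 9.22, Lemma 9.28. [ONeillSemiRiemannian1983]
-/

noncomputable section

open Bundle Set Filter Function
open scoped Manifold ContDiff Topology

namespace Literature.Geometry.Lorentzian

namespace PseudoRiemannianMetric

variable {E : Type*} [NormedAddCommGroup E] [NormedSpace ℝ E] [FiniteDimensional ℝ E]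
  [CompleteSpace E] {H : Type*} [TopologicalSpace H] {I : ModelWithCorners ℝ E H}
  {M : Type*} [TopologicalSpace M] [ChartedSpace H M] [IsManifold I ∞ M] {n : ℕ∞ω} [Fact (1 ≤ n)]
  {g : PseudoRiemannianMetric I n E (TangentSpace I : M → Type _)} [g.HasLeviCivita]
  {T : Π x : M, TangentSpace I x}

/-! ### Locality in the germ -/

/-- **The Killing property on a set is local in the germ of the field**: if around each point of
`D` the field `L` agrees on an open neighbourhood with some Killing field of that neighbourhood,
then `L` is a Killing field on `D` (smoothness is local; the Killing equation at `z` only involves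
`(∇L)_z`, which depends on the germ of `L` at `z`, `leviCivita_congr_nhds`). O'Neill 1983, Ch. 9,
Def. 9.22 (Killing fields of open submanifolds). [cite: ONeillSemiRiemannian1983, Ch. 9, Def. 9.22] -/
theorem IsKillingFieldOn.of_locally {L : Π x : M, TangentSpace I x} {D : Set M}
    (h : ∀ z ∈ D, ∃ (S : Set M) (L' : Π x : M, TangentSpace I x),
      IsOpen S ∧ z ∈ S ∧ g.IsKillingFieldOn L' S ∧ ∀ w ∈ S, L w = L' w) :
    g.IsKillingFieldOn L D := by
  refine ⟨fun z hz ↦ ?_, fun z hz Y₀ Z₀ ↦ ?_⟩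
  · obtain ⟨S, L', hS, hzS, hL', hagree⟩ := h z hz
    have hev : (fun y ↦ (TotalSpace.mk' E y (L y) : TangentBundle I M)) =ᶠ[𝓝 z]
        (fun y ↦ (TotalSpace.mk' E y (L' y) : TangentBundle I M)) := by
      filter_upwards [hS.mem_nhds hzS] with y hy
      rw [hagree y hy]
    exact ((hL'.contMDiffAt hS hzS).congr_of_eventuallyEq hev).contMDiffWithinAt
  · obtain ⟨S, L', hS, hzS, hL', hagree⟩ := h z hz
    have hev : L =ᶠ[𝓝 z] L' := by
      filter_upwards [hS.mem_nhds hzS] with y hy using hagree y hy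
    rw [leviCivita_congr_nhds g hev]
    exact hL'.2 z hzS Y₀ Z₀

omit [FiniteDimensional ℝ E] [CompleteSpace E] [Fact (1 ≤ n)] [g.HasLeviCivita] [IsManifold I ∞ M] in
/-- **The commutation clause `[T, L] = 0` is local in the germ of `L`** (locality of the Lie bracket,
Mathlib's `Filter.EventuallyEq.mlieBracket_vectorField_eq`). [folklore] -/
theorem mlieBracket_eq_zero_of_locally {L : Π x : M, TangentSpace I x} {D : Set M}
    (h : ∀ z ∈ D, ∃ (S : Set M) (L' : Π x : M, TangentSpace I x),
      IsOpen S ∧ z ∈ S ∧ (∀ w ∈ S, VectorField.mlieBracket I T L' w = 0) ∧ ∀ w ∈ S, L w = L' w) :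
    ∀ z ∈ D, VectorField.mlieBracket I T L z = 0 := by
  intro z hz
  obtain ⟨S, L', hS, hzS, hL', hagree⟩ := h z hz
  have hev : L =ᶠ[𝓝 z] L' := by
    filter_upwards [hS.mem_nhds hzS] with y hy using hagree y hy
  rw [(Filter.EventuallyEq.rfl (f := T)).mlieBracket_vectorField_eq hev]
  exact hL' z hzS

/-! ### The continuation theorem -/

/-- **Continuation of a `T`-commuting local Killing field along a connected open region, given local
extendability and coherence.**  Let `A ⊆ M` be open and connected, `N₀ ⊆ A` open, connected and
non-empty, and `Z₀` a Killing field of `g` on `N₀` with `[T, Z₀] = 0` on `N₀`.  Assume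
(LOCAL EXTENDABILITY) every `x ∈ A` has an open connected neighbourhood `S ⊆ A` such that every
`y ∈ S` has arbitrarily small open neighbourhoods `B ⊆ S` from which every `T`-commuting Killing
field on `B` extends to a `T`-commuting Killing field on `S`; and (COHERENCE) whenever `L₁` is a
`T`-commuting Killing field on a connected open `D₁`, `N₀ ⊆ D₁ ⊆ A`, extending `Z₀`, and `L₂` a
`T`-commuting Killing field on a connected open `D₂ ⊆ A` agreeing with `L₁` on a non-empty open
subset of `D₁ ∩ D₂`, then `L₁ = L₂` on `D₁ ∩ D₂`.  Then `Z₀` extends to a `T`-commuting Killing field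
on `A`.  Proof: partial continuations `(D, L)` (connected open `D`, `N₀ ⊆ D ⊆ A`, `L` a `T`-commuting
Killing field on `D` extending `Z₀`), ordered by the inclusion of their graphs, have upper bounds of
chains (unions), so Zorn gives a maximal one; if `D ≠ A`, a point `x ∈ A ∩ ∂D` has a neighbourhood
`S` as in the first hypothesis, `L` restricted to a small `B ⊆ D ∩ S` extends to `S`, the extension
agrees with `L` on `D ∩ S` by coherence, and `(D ∪ S, L ∪ L')` is a strictly larger continuation.
Nomizu 1960, Thms. 1–2 (with simple connectivity in place of coherence); Chruściel 1997, Thm. 2.1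
and proof of Thm. 1.1. [cite: Chrusciel1997, Thm. 2.1 and proof of Thm. 1.1] -/
theorem IsKillingFieldOn.exists_extension_of_coherent
    {A N₀ : Set M} {Z₀ : Π x : M, TangentSpace I x}
    (hA : IsOpen A) (hAc : IsConnected A) (hN₀ : IsOpen N₀) (hN₀c : IsConnected N₀)
    (hN₀A : N₀ ⊆ A) (hZ₀ : g.IsKillingFieldOn Z₀ N₀)
    (hTZ₀ : ∀ z ∈ N₀, VectorField.mlieBracket I T Z₀ z = 0)
    (hloc : ∀ x ∈ A, ∃ S : Set M, IsOpen S ∧ x ∈ S ∧ S ⊆ A ∧ IsConnected S ∧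
      ∀ y ∈ S, ∀ N ∈ 𝓝 y, ∃ B : Set M, IsOpen B ∧ y ∈ B ∧ B ⊆ N ∩ S ∧
        ∀ L : Π x : M, TangentSpace I x, g.IsKillingFieldOn L B →
          (∀ z ∈ B, VectorField.mlieBracket I T L z = 0) →
          ∃ L' : Π x : M, TangentSpace I x, g.IsKillingFieldOn L' S ∧
            (∀ z ∈ S, VectorField.mlieBracket I T L' z = 0) ∧ ∀ z ∈ B, L' z = L z)
    (hcoh : ∀ (D₁ D₂ : Set M) (L₁ L₂ : Π x : M, TangentSpace I x),
      IsOpen D₁ → IsConnected D₁ → IsOpen D₂ → IsConnected D₂ → D₁ ⊆ A → D₂ ⊆ A →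
      N₀ ⊆ D₁ → (∀ z ∈ N₀, L₁ z = Z₀ z) →
      g.IsKillingFieldOn L₁ D₁ → (∀ z ∈ D₁, VectorField.mlieBracket I T L₁ z = 0) →
      g.IsKillingFieldOn L₂ D₂ → (∀ z ∈ D₂, VectorField.mlieBracket I T L₂ z = 0) →
      (∃ O' : Set M, IsOpen O' ∧ O'.Nonempty ∧ O' ⊆ D₁ ∩ D₂ ∧ ∀ z ∈ O', L₁ z = L₂ z) →
      ∀ z ∈ D₁ ∩ D₂, L₁ z = L₂ z) :
    ∃ L : Π x : M, TangentSpace I x, g.IsKillingFieldOn L A ∧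
      (∀ z ∈ A, VectorField.mlieBracket I T L z = 0) ∧ ∀ z ∈ N₀, L z = Z₀ z := by
  classical
  -- partial continuations and their graphs
  set Good : Set M → (Π x : M, TangentSpace I x) → Prop := fun D L ↦
    IsOpen D ∧ IsConnected D ∧ N₀ ⊆ D ∧ D ⊆ A ∧ g.IsKillingFieldOn L D ∧
      (∀ z ∈ D, VectorField.mlieBracket I T L z = 0) ∧ ∀ z ∈ N₀, L z = Z₀ z with hGood
  set graph : Set M → (Π x : M, TangentSpace I x) → Set (M × E) := fun D L ↦
    {q | q.1 ∈ D ∧ q.2 = L q.1} with hgraph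
  set 𝒮 : Set (Set (M × E)) := {G | ∃ (D : Set M) (L : Π x : M, TangentSpace I x),
    Good D L ∧ G = graph D L} with h𝒮
  -- graph inclusion = extension
  have hsub : ∀ (D D' : Set M) (L L' : Π x : M, TangentSpace I x),
      graph D L ⊆ graph D' L' ↔ D ⊆ D' ∧ ∀ z ∈ D, L z = L' z := by
    intro D D' L L'
    constructor
    · intro h
      have key : ∀ z ∈ D, z ∈ D' ∧ L z = L' z := fun z hz ↦ by
        have hm : ((z, L z) : M × E) ∈ graph D' L' := h ⟨hz, rfl⟩
        exact ⟨hm.1, hm.2⟩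
      exact ⟨fun z hz ↦ (key z hz).1, fun z hz ↦ (key z hz).2⟩
    · rintro ⟨hDD', hLL'⟩ ⟨z, v⟩ ⟨hz, hv⟩
      exact ⟨hDD' hz, by rw [hv]; exact hLL' z hz⟩
  obtain ⟨x₀, hx₀⟩ := hN₀c.nonempty
  -- chains have upper bounds
  have hchain : ∀ c ⊆ 𝒮, IsChain (· ⊆ ·) c → c.Nonempty → ∃ ub ∈ 𝒮, ∀ s ∈ c, s ⊆ ub := by
    intro c hc𝒮 hchain hcne
    have hex : ∀ G : c, ∃ (D : Set M) (L : Π x : M, TangentSpace I x),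
        Good D L ∧ (G : Set (M × E)) = graph D L := fun G ↦ hc𝒮 G.2
    choose Dc Lc hDc hGc using hex
    -- the union
    let Dstar : Set M := ⋃ G : c, Dc G
    have hmemD : ∀ {z : M}, z ∈ Dstar ↔ ∃ G : c, z ∈ Dc G := by
      intro z; exact mem_iUnion
    let Lstar : Π x : M, TangentSpace I x := fun z ↦
      if h : ∃ G : c, z ∈ Dc G then Lc h.choose z else 0
    -- agreement of the members of the chain on common points
    have hagree : ∀ (G G' : c) (z : M), z ∈ Dc G → z ∈ Dc G' → Lc G z = Lc G' z := by
      intro G G' z hz hz'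
      rcases hchain.total G.2 G'.2 with h | h
      · have h' : graph (Dc G) (Lc G) ⊆ graph (Dc G') (Lc G') := by rwa [← hGc G, ← hGc G']
        exact ((hsub _ _ _ _).1 h').2 z hz
      · have h' : graph (Dc G') (Lc G') ⊆ graph (Dc G) (Lc G) := by rwa [← hGc G, ← hGc G']
        exact (((hsub _ _ _ _).1 h').2 z hz').symm
    have hLstar : ∀ (G : c) (z : M), z ∈ Dc G → Lstar z = Lc G z := by
      intro G z hz
      have h : ∃ G : c, z ∈ Dc G := ⟨G, hz⟩
      show (if h : ∃ G : c, z ∈ Dc G then Lc h.choose z else 0) = Lc G z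
      rw [dif_pos h]
      exact hagree h.choose G z h.choose_spec hz
    -- the union is a partial continuation
    have hne : Nonempty c := hcne.to_subtype
    have hgood : Good Dstar Lstar := by
      refine ⟨isOpen_iUnion fun G ↦ (hDc G).1, ?_, ?_, ?_, ?_, ?_, ?_⟩
      · refine ⟨⟨x₀, hmemD.2 ⟨Classical.arbitrary c, (hDc _).2.2.1 hx₀⟩⟩, ?_⟩
        exact isPreconnected_iUnion (s := fun G : c ↦ Dc G)
          ⟨x₀, mem_iInter.2 fun G ↦ (hDc G).2.2.1 hx₀⟩ fun G ↦ (hDc G).2.1.isPreconnected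
      · exact fun z hz ↦ hmemD.2 ⟨Classical.arbitrary c, (hDc _).2.2.1 hz⟩
      · exact iUnion_subset fun G ↦ (hDc G).2.2.2.1
      · refine IsKillingFieldOn.of_locally fun z hz ↦ ?_
        obtain ⟨G, hzG⟩ := hmemD.1 hz
        exact ⟨Dc G, Lc G, (hDc G).1, hzG, (hDc G).2.2.2.2.1, fun w hw ↦ hLstar G w hw⟩
      · refine mlieBracket_eq_zero_of_locally fun z hz ↦ ?_
        obtain ⟨G, hzG⟩ := hmemD.1 hz
        exact ⟨Dc G, Lc G, (hDc G).1, hzG, (hDc G).2.2.2.2.2.1, fun w hw ↦ hLstar G w hw⟩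
      · intro z hz
        let G : c := Classical.arbitrary c
        rw [hLstar G z ((hDc G).2.2.1 hz)]
        exact (hDc G).2.2.2.2.2.2 z hz
    refine ⟨graph Dstar Lstar, ⟨Dstar, Lstar, hgood, rfl⟩, fun s hs ↦ ?_⟩
    have hs' : s = graph (Dc ⟨s, hs⟩) (Lc ⟨s, hs⟩) := hGc ⟨s, hs⟩
    rw [hs']
    exact (hsub _ _ _ _).2 ⟨subset_iUnion (fun G : c ↦ Dc G) ⟨s, hs⟩,
      fun z hz ↦ (hLstar ⟨s, hs⟩ z hz).symm⟩
  -- the seed is a partial continuation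
  have hseed : graph N₀ Z₀ ∈ 𝒮 :=
    ⟨N₀, Z₀, ⟨hN₀, hN₀c, Subset.rfl, hN₀A, hZ₀, hTZ₀, fun _ _ ↦ rfl⟩, rfl⟩
  -- Zorn
  obtain ⟨m, hseedm, hmax⟩ := zorn_subset_nonempty 𝒮 hchain (graph N₀ Z₀) hseed
  obtain ⟨D, L, hDL, rfl⟩ := hmax.prop
  obtain ⟨hDo, hDc, hN₀D, hDA, hLK, hLT, hLZ₀⟩ := hDL
  -- the maximal continuation is total
  suffices hDA' : A ⊆ D by
    have hDeq : D = A := Subset.antisymm hDA hDA'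
    subst hDeq
    exact ⟨L, hLK, hLT, hLZ₀⟩
  by_contra hnot
  -- a boundary point of `D` inside `A`
  have hbdry : ∃ x ∈ A, x ∈ closure D ∧ x ∉ D := by
    by_contra hno
    push Not at hno
    have hcover : A ⊆ D ∪ (closure D)ᶜ := fun z hz ↦ by
      by_cases hzD : z ∈ D
      · exact Or.inl hzD
      · exact Or.inr fun hzc ↦ hzD (hno z hz hzc)
    obtain ⟨z, hzA, hzD⟩ := not_subset.1 hnot
    have h1 : (A ∩ D).Nonempty := ⟨x₀, hN₀A hx₀, hN₀D hx₀⟩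
    have h2 : (A ∩ (closure D)ᶜ).Nonempty := ⟨z, hzA, fun hzc ↦ hzD (hno z hzA hzc)⟩
    obtain ⟨w, -, hwD, hwc⟩ := hAc.isPreconnected D (closure D)ᶜ hDo isClosed_closure.isOpen_compl
      hcover h1 h2
    exact hwc (subset_closure hwD)
  obtain ⟨x, hxA, hxcl, hxD⟩ := hbdry
  obtain ⟨S, hSo, hxS, hSA, hSc, hSext⟩ := hloc x hxA
  -- a point of `D` in `S` and a small ball there
  obtain ⟨y, hyS, hyD⟩ : (S ∩ D).Nonempty := mem_closure_iff.1 hxcl S hSo hxS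
  obtain ⟨B, hBo, hyB, hBsub, hBext⟩ := hSext y hyS D (hDo.mem_nhds hyD)
  have hBD : B ⊆ D := fun z hz ↦ (hBsub hz).1
  have hBS : B ⊆ S := fun z hz ↦ (hBsub hz).2
  obtain ⟨L', hL'K, hL'T, hL'B⟩ := hBext L (hLK.mono hBD) fun z hz ↦ hLT z (hBD hz)
  -- coherence: `L = L'` on `D ∩ S`
  have hagree : ∀ z ∈ D ∩ S, L z = L' z :=
    hcoh D S L L' hDo hDc hSo hSc hDA hSA hN₀D hLZ₀ hLK hLT hL'K hL'T
      ⟨B, hBo, ⟨y, hyB⟩, fun z hz ↦ ⟨hBD hz, hBS hz⟩, fun z hz ↦ (hL'B z hz).symm⟩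
  -- the glued continuation on `D ∪ S`
  let L'' : Π x : M, TangentSpace I x := fun z ↦ if z ∈ D then L z else L' z
  have hL''D : ∀ z ∈ D, L'' z = L z := fun z hz ↦ by
    show (if z ∈ D then L z else L' z) = L z
    rw [if_pos hz]
  have hL''S : ∀ z ∈ S, L'' z = L' z := fun z hz ↦ by
    show (if z ∈ D then L z else L' z) = L' z
    by_cases hzD : z ∈ D
    · rw [if_pos hzD]; exact hagree z ⟨hzD, hz⟩
    · rw [if_neg hzD]
  have hgood'' : Good (D ∪ S) L'' := by
    refine ⟨hDo.union hSo, IsConnected.union ⟨y, hyD, hyS⟩ hDc hSc,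
      hN₀D.trans subset_union_left, union_subset hDA hSA, ?_, ?_, ?_⟩
    · refine IsKillingFieldOn.of_locally fun z hz ↦ ?_
      rcases hz with hz | hz
      · exact ⟨D, L, hDo, hz, hLK, hL''D⟩
      · exact ⟨S, L', hSo, hz, hL'K, hL''S⟩
    · refine mlieBracket_eq_zero_of_locally fun z hz ↦ ?_
      rcases hz with hz | hz
      · exact ⟨D, L, hDo, hz, hLT, hL''D⟩
      · exact ⟨S, L', hSo, hz, hL'T, hL''S⟩
    · intro z hz
      rw [hL''D z (hN₀D hz)]
      exact hLZ₀ z hz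
  have hmem'' : graph (D ∪ S) L'' ∈ 𝒮 := ⟨D ∪ S, L'', hgood'', rfl⟩
  have hle : graph D L ⊆ graph (D ∪ S) L'' :=
    (hsub _ _ _ _).2 ⟨subset_union_left, fun z hz ↦ (hL''D z hz).symm⟩
  have hge : graph (D ∪ S) L'' ⊆ graph D L := hmax.le_of_ge hmem'' hle
  have hSD : S ⊆ D := fun z hz ↦ (((hsub _ _ _ _).1 hge).1 (Or.inr hz))
  exact hxD (hSD hxS)

end PseudoRiemannianMetric

end Literature.Geometry.Lorentzian

end
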